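import Literature.MathematicalPhysics.QuantumFieldTheory.Balaban1983to89.B9Eq334GaugeCovarianceZd
import Literature.MathematicalPhysics.QuantumFieldTheory.Balaban1983to89.B9SupplySockB9P3ZdFrame

/-!
# `Balaban1983to89.B9Eq347GlobalNormsGaugeInvariantZd` — [Balaban1985BackgroundPropagators] p. 398 «All these inequalities are invariant with respect to gauge
# transformations of U» FOR THE (3.47) GLOBAL ENTRIES OF THE `ℤᵈ` FRAME (`B9SupplySockB9P3ZdFrame.globZd`, n = 0, 1, 3: the weighted sup norms (3.41) of `G(U₀)J`,
# `∇_{U₀}G(U₀)J`, `Δ_{U₀}G(U₀)J` DEFINED from the operator letter): when `G(U₀)` is gauge covariant ((3.34), `B9Eq334GaugeCovarianceZd`), the entries at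
# `(U₀^u, R(u)J)` equal the entries at `(U₀, J)`, the weighted norm (3.41) of `R(u)J` equals that of `J`, and hence the (3.47) clause of Theorem 3.3's block
# `B9.Ineq342_346_347 (GAZd …) B₀ δ₀` (the junction's `h33U`, global part) is a GAUGE-ORBIT STATEMENT — the (3.36) reduction step of Theorem 3.3 at the junction

statement-level skeleton of published theorems with citation tags; proofs where landed; nothing here is a claim about the
Yang–Mills mass gap

T. Bałaban, *Propagators for lattice gauge theories in a background field*, Commun. Math. Phys. **99** (1985) 389–434 [`Balaban1985BackgroundPropagators`,
"B9"], journal page = PDF page + 388.  THE PRINT (verbatim).  p. 397 (3.41) «|λ|_{(γ)} = sup_j sup_{x∈Ω_j} (Lʲη)^{−γ}|λ(x)|»; p. 398 (3.47) «|Gλ|_{(2+γ)},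
|∇_UGλ|_{(1+γ)}, |G∇\*_Uλ|_{(1+γ)}, |Δ_UGλ|_{(γ)} ≤ B₀|λ|_{(γ)}» and, after (3.47): «All these inequalities are invariant with respect to gauge transformations of U»;
p. 396 (3.34) «G(U^u) = R(u)G(U)R(u⁻¹)», (3.35)–(3.36) (the class is an orbit condition; on each cube `U^u = e^{iηA}` small); p. 399 Theorem 3.3.

CITATION HEADER ∕ WHY THIS FILE (cell `pub-ymgap`, HUMAN RULING D-0062 ∕ D-0149; width seat `pub-ymgap-dag-n06-w3` (g3), node N06 = [B9]; CLAIM-2 FILE F — the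
(3.36) gauge-reduction sub-step of WIDTH-207 piece 1 «[B9] Thm 3.3 blocks `h33U`» at the `ℤᵈ` junction).  dag-n06-w4 g2's supplier `sockB9P3D4γI_at_opsAllZd`
displays `h33U : ∀ α₀ U₀ unitary, Reg335 → B9.Ineq342_346_347 (GA (mem M i m)) B₀ δ₀ (ιCfg M i m U₀ hU₀)`; at dag-n06-e's `ℤᵈ` frame the kernel family
`GAZd 𝔸 L len x ops loc` takes its (3.47) global entries n = 0, 1, 3 from the operator letter `ops.Gop` (`globZd`; n = 2 and the local entries are letters
`loc`).  THIS FILE: the weighted sup norm `msup` is invariant under pointwise rotation by unit-bounded units (`norm_conjR`); with (3.34) for `ops.Gop` the three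
global entries are orbit invariants; so the (3.47) clause transfers `U₀ ↦ U₀^u` (and back), the n = 2 letter's invariance displayed.  For the genuine record
`opsAllZd` (finite `Ω₀`) the covariance input is `B9Eq334GaugeCovarianceZd.gop_opsAllZd_gaugeAct` (P₀ box clause).  INPUTS BY NAME: `B8Ineq132.norm_conjR`,
`B9Eq340HolderZd.covDerivFwd_gaugeAct`, `B8Ineq159GaugeCovariance.covLap_gaugeAct`, `B9SupplySockB9P3ZdFrame` (`globZd ∕ GAZd ∕ geoZd ∕ bgZd ∕ CfgZd`), FILE B.

WHAT IS PROVED (theorems only, 0 definitions; no `instance`, no `notation`; kernel, 0 sorry).  `u : ℤᵈ → 𝔸ˣ` unitary-valued (hence in `U1`), `U₀` unitary-valued.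
* §1 ★ `msup_conjR` (`|R(v)F|_{(α)} = |F|_{(α)}` for pointwise unit-bounded rotations), `bondNorm_rotB` (the (3.41) norm of `R(u)J` is that of `J`).
* §2 for ANY letter record `ops` with `ops.Gop (U₀^u) (R(u)J) = R(u)(ops.Gop U₀ J)` (all `J`): ★★ `globZd_zero_gaugeAct` ∕ `globZd_one_gaugeAct` ∕ `globZd_three_gaugeAct`
  (the (3.47) entries n = 0, 1, 3 at `(U₀^u, R(u)J)` equal those at `(U₀, J)`).
* §3 ★★★ `glob347_gaugeAct_iff` — the (3.47) clause of `B9.Ineq342_346_347 (GAZd 𝔸 L len x ops loc) B₀ δ₀` holds at `U₀^u` iff at `U₀`, given the covariance of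
  `ops.Gop` at `(U₀, u)` and the invariance of the n = 2 letter `loc.glob2` (displayed).
* §4 ★★ `glob347_opsAllZd_gaugeAct_iff` — the same for the genuine four-letter record `opsAllZd τ L ΛbP ops₀ x.M x.i x.m` at a member with finite `Ω₀` (`τ`
  tracial Hermitian faithful, `2 ≤ L`, P₀ box clause), n = 2 letter invariance displayed.

HONEST SCOPE.  Norm bookkeeping + (3.34); the LOCAL clauses (3.42)∕(3.46) of `Ineq342_346_347` concern the letters `loc` and are NOT treated; no estimate of
[B9]; Theorem 3.3 at curved `U₀` NOT proved; count-neutral; N05 ∕ N06 NOT discharged; K1⁷ `stmt-QuantumFields-20542` NOT closed; one finite `𝕋⁴` programme at fixed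
`ε`, Bałaban as printed; R4 closes only the conditional finite-`𝕋⁴` rung `BalabanLadder.UV` — nothing continuum ∕ ℝ⁴ ∕ OS ∕ mass gap ∕ Clay.  Unit `pub-ymgap-dag-n06-w3`
(g3), 2026-08-28.
-/

noncomputable section

namespace Literature.MathematicalPhysics.QuantumFieldTheory.Balaban1983to89.B9Eq347GlobalNormsGaugeInvariantZd

open B7Prop1Explicit B7Eq78Linearization
open B7Prop1Local (InBox loK bondHiK)
open B7Prop2Explicit (unitaryUnits unitaryUnits_le_U1)
open B8Ineq132 (covDerivFwd BondTouches norm_conjR)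
open B8Eq140Level (SideTouches)
open B8ScaledSupNorm (bondNorm msup weight Idx)
open B8Eq138LandauZd (covLap)
open B8Ineq159GaugeCovariance (covLap_gaugeAct)
open B9Eq340HolderZd (covDerivFwd_gaugeAct)
open B8LeafModelZd (ZdIdx)
open B9SupplySockB9P3ZdLetters (OpsZd)
open B9SupplySockB9P3ZdFrame
open B9SupplySockB9P3ZdAllLettersZd (opsAllZd)
open B9Eq333ProjectionCovarianceZd (inv_mem_unitaryUnits gaugeAct_inv_gaugeAct)
open B9Eq334GaugeCovarianceZd

-- `Site` alone could resolve to the torus sites of `Setup.lean`; re-export the `ℤ^d` sites of `B7Prop1Explicit`.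
export B7Prop1Explicit (Site)

variable {d : ℕ}

/-! ## §1  The weighted sup norm (3.41) is invariant under pointwise unit rotations -/

section Norms

variable {𝔸 : Type*} [CStarAlgebra 𝔸] [Nontrivial 𝔸]

/-- ★ **`|R(v)F|_{(α)} = |F|_{(α)}`**: the weighted sup norm of a family rotated pointwise by units `v i` with `|v i|, |v i⁻¹| ≤ 1` equals that of the family
(`‖R(v)X‖ = ‖X‖`). [cite: Balaban1985BackgroundPropagators, (3.41) p.397, p.398 («invariant with respect to gauge transformations»); Balaban1985RegularSpaces, p.86] -/
theorem msup_conjR {ι : Type*} (L k : ℕ) (η α : ℝ) (mem : ℕ → ι → Prop) {v : ι → 𝔸ˣ} (hv : ∀ i, v i ∈ U1 𝔸) (F : ι → 𝔸) :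
    msup L k η α mem (fun i => conjR (v i) (F i)) = msup L k η α mem F := by
  unfold msup
  congr 1
  funext p
  rw [norm_conjR (hv p.1.2)]

/-- **THE (3.41) NORM OF `R(u)J` IS THAT OF `J`** (`u` unitary). [cite: Balaban1985BackgroundPropagators, (3.41) p.397, p.398] -/
theorem bondNorm_rotB (L k : ℕ) (η γ : ℝ) (Ω : ℕ → Set (Site d)) {u : Site d → 𝔸ˣ} (hu : ∀ z, u z ∈ unitaryUnits 𝔸) (J : Site d → Fin d → 𝔸) :
    bondNorm L k η γ Ω (rotB u J) = bondNorm L k η γ Ω J := by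
  unfold bondNorm
  exact msup_conjR L k η γ _ (fun b : Site d × Fin d => unitaryUnits_le_U1 (hu b.1)) fun b : Site d × Fin d => J b.1 b.2

/-- the frame's weighted norm `wNorm γ` ((3.41) at the member) of `R(u)J` is that of `J`. [cite: Balaban1985BackgroundPropagators, (3.41) p.397] -/
theorem geoZd_wNorm_rotB {𝔸 : Type} [CStarAlgebra 𝔸] [Nontrivial 𝔸] {L : ℕ} {len : Site d → ℝ} (x : MemberZd d L) {u : Site d → 𝔸ˣ}
    (hu : ∀ z, u z ∈ unitaryUnits 𝔸) (γ : ℝ) (J : Site d → Fin d → 𝔸) :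
    (geoZd 𝔸 L len x).wNorm γ (rotB u J) = (geoZd 𝔸 L len x).wNorm γ J :=
  bondNorm_rotB L x.m x.i.η γ x.i.Ω hu J

end Norms

/-! ## §2  The (3.47) global entries n = 0, 1, 3 of the `ℤᵈ` frame are orbit invariants when `G(U₀)` is covariant -/

section Frame

variable {𝔸 : Type} [CStarAlgebra 𝔸] [Nontrivial 𝔸] {L : ℕ} {len : Site d → ℝ} (x : MemberZd d L) (ops : OpsZd d 𝔸)
  (glob2 : CfgZd d 𝔸 → (Site d → Fin d → 𝔸) → ℝ → ℝ) {u : Site d → 𝔸ˣ} {U₀ : Site d → Fin d → 𝔸ˣ}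
  (hU₀ : ∀ z κ, U₀ z κ ∈ unitaryUnits 𝔸) (hu : ∀ z, u z ∈ unitaryUnits 𝔸)
  (hG : ∀ J : Site d → Fin d → 𝔸, ops.Gop (gaugeAct u U₀) (rotB u J) = rotB u (ops.Gop U₀ J))
include hG

/-- ★★ **n = 0: `|G(U₀^u)R(u)J|_{(2+γ)} = |G(U₀)J|_{(2+γ)}`**. [cite: Balaban1985BackgroundPropagators, (3.47) p.398, (3.34) p.396] -/
theorem globZd_zero_gaugeAct (J : Site d → Fin d → 𝔸) (γ : ℝ) :
    globZd 𝔸 L x ops glob2 0 ⟨gaugeAct u U₀, gaugeAct_mem_unitaryUnits' hU₀ hu⟩ (rotB u J) γ = globZd 𝔸 L x ops glob2 0 ⟨U₀, hU₀⟩ J γ := by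
  show msup L x.m x.i.η (2 + γ) (fun j (b : Site d × Fin d) => SideTouches (x.i.Ω j) b.1 b.2) (fun b => ops.Gop (gaugeAct u U₀) (rotB u J) b.1 b.2) =
    msup L x.m x.i.η (2 + γ) (fun j (b : Site d × Fin d) => SideTouches (x.i.Ω j) b.1 b.2) (fun b => ops.Gop U₀ J b.1 b.2)
  rw [hG J]
  exact msup_conjR L x.m x.i.η (2 + γ) _ (fun b : Site d × Fin d => unitaryUnits_le_U1 (hu b.1)) _

/-- ★★ **n = 1: `|∇_{U₀^u}G(U₀^u)R(u)J|_{(1+γ)} = |∇_{U₀}G(U₀)J|_{(1+γ)}`** (`covDerivFwd_gaugeAct`). [cite: Balaban1985BackgroundPropagators, (3.47) p.398, (3.34) p.396; Balaban1985RegularSpaces, (1.1) p.76] -/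
theorem globZd_one_gaugeAct (J : Site d → Fin d → 𝔸) (γ : ℝ) :
    globZd 𝔸 L x ops glob2 1 ⟨gaugeAct u U₀, gaugeAct_mem_unitaryUnits' hU₀ hu⟩ (rotB u J) γ = globZd 𝔸 L x ops glob2 1 ⟨U₀, hU₀⟩ J γ := by
  show msup L x.m x.i.η (1 + γ) (fun j (t : Fin d × Fin d × Site d) => SideTouches (x.i.Ω j) t.2.2 t.2.1)
      (fun t => covDerivFwd x.i.η (gaugeAct u U₀) t.1 (fun z => ops.Gop (gaugeAct u U₀) (rotB u J) z t.2.1) t.2.2) =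
    msup L x.m x.i.η (1 + γ) (fun j (t : Fin d × Fin d × Site d) => SideTouches (x.i.Ω j) t.2.2 t.2.1)
      (fun t => covDerivFwd x.i.η U₀ t.1 (fun z => ops.Gop U₀ J z t.2.1) t.2.2)
  have hrot : (fun t : Fin d × Fin d × Site d => covDerivFwd x.i.η (gaugeAct u U₀) t.1 (fun z => ops.Gop (gaugeAct u U₀) (rotB u J) z t.2.1) t.2.2) =
      fun t => conjR (u t.2.2) (covDerivFwd x.i.η U₀ t.1 (fun z => ops.Gop U₀ J z t.2.1) t.2.2) := by
    funext t
    rw [hG J]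
    exact covDerivFwd_gaugeAct x.i.η u U₀ t.1 (F := fun z => ops.Gop U₀ J z t.2.1) (fun z => rfl) t.2.2
  rw [hrot]
  exact msup_conjR L x.m x.i.η (1 + γ) _ (fun t : Fin d × Fin d × Site d => unitaryUnits_le_U1 (hu t.2.2)) _

/-- ★★ **n = 3: `|Δ_{U₀^u}G(U₀^u)R(u)J|_{(γ)} = |Δ_{U₀}G(U₀)J|_{(γ)}`** (`covLap_gaugeAct`). [cite: Balaban1985BackgroundPropagators, (3.47) p.398, (3.34) p.396; Balaban1985RegularSpaces, (1.39) p.83] -/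
theorem globZd_three_gaugeAct (J : Site d → Fin d → 𝔸) (γ : ℝ) :
    globZd 𝔸 L x ops glob2 3 ⟨gaugeAct u U₀, gaugeAct_mem_unitaryUnits' hU₀ hu⟩ (rotB u J) γ = globZd 𝔸 L x ops glob2 3 ⟨U₀, hU₀⟩ J γ := by
  show bondNorm L x.m x.i.η γ x.i.Ω (fun z μ => covLap x.i.η (gaugeAct u U₀) (fun w => ops.Gop (gaugeAct u U₀) (rotB u J) w μ) z) =
    bondNorm L x.m x.i.η γ x.i.Ω (fun z μ => covLap x.i.η U₀ (fun w => ops.Gop U₀ J w μ) z)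
  have hrot : (fun z μ => covLap x.i.η (gaugeAct u U₀) (fun w => ops.Gop (gaugeAct u U₀) (rotB u J) w μ) z) =
      rotB u (fun z μ => covLap x.i.η U₀ (fun w => ops.Gop U₀ J w μ) z) := by
    funext z μ
    rw [hG J, rotB_apply]
    exact covLap_gaugeAct x.i.η u U₀ (fun w => ops.Gop U₀ J w μ) z
  rw [hrot, bondNorm_rotB L x.m x.i.η γ x.i.Ω hu]

/-! ## §3  The (3.47) clause of Theorem 3.3's block is a gauge-orbit statement -/

/-- ★★★ **THE (3.47) CLAUSE IS AN ORBIT STATEMENT**: for a record whose `G(U₀)` is covariant at `(U₀, u)` and an n = 2 letter invariant there, the third clause of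
`B9.Ineq342_346_347 (GAZd 𝔸 L len x ops loc) B₀ δ₀` («|…|_{(n+γ)} ≤ B₀|J|_{(γ)}, |γ| ≤ 4, n = 0,…,3, all J») holds at `U₀^u` iff it holds at `U₀` (`J ↦ R(u)J` is a
bijection of the bond fields). [cite: Balaban1985BackgroundPropagators, (3.47) p.398, p.398 («invariant with respect to gauge transformations of U»), (3.34)–(3.36) p.396, Thm 3.3 p.399] -/
theorem glob347_gaugeAct_iff (loc : LocalLettersZd 𝔸 L x)
    (hglob2 : ∀ (J : Site d → Fin d → 𝔸) (γ : ℝ), loc.glob2 ⟨gaugeAct u U₀, gaugeAct_mem_unitaryUnits' hU₀ hu⟩ (rotB u J) γ = loc.glob2 ⟨U₀, hU₀⟩ J γ)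
    (B₀ : ℝ) :
    (∀ (n : Fin 4) (J : Site d → Fin d → 𝔸) (γ : ℝ), -4 ≤ γ → γ ≤ 4 →
        (GAZd 𝔸 L len x ops loc).glob n ⟨gaugeAct u U₀, gaugeAct_mem_unitaryUnits' hU₀ hu⟩ J γ ≤ B₀ * (geoZd 𝔸 L len x).wNorm γ J) ↔
      (∀ (n : Fin 4) (J : Site d → Fin d → 𝔸) (γ : ℝ), -4 ≤ γ → γ ≤ 4 →
        (GAZd 𝔸 L len x ops loc).glob n ⟨U₀, hU₀⟩ J γ ≤ B₀ * (geoZd 𝔸 L len x).wNorm γ J) := by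
  -- every entry at `(U₀^u, R(u)J)` equals the entry at `(U₀, J)`
  have hentry : ∀ (n : Fin 4) (J : Site d → Fin d → 𝔸) (γ : ℝ),
      (GAZd 𝔸 L len x ops loc).glob n ⟨gaugeAct u U₀, gaugeAct_mem_unitaryUnits' hU₀ hu⟩ (rotB u J) γ = (GAZd 𝔸 L len x ops loc).glob n ⟨U₀, hU₀⟩ J γ := by
    intro n J γ
    fin_cases n
    · exact globZd_zero_gaugeAct x ops loc.glob2 hU₀ hu hG J γ
    · exact globZd_one_gaugeAct x ops loc.glob2 hU₀ hu hG J γ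
    · exact hglob2 J γ
    · exact globZd_three_gaugeAct x ops loc.glob2 hU₀ hu hG J γ
  constructor
  · intro h n J γ h1 h2
    have h' := h n (rotB u J) γ h1 h2
    rwa [hentry, geoZd_wNorm_rotB x hu] at h'
  · intro h n J γ h1 h2
    have h' := h n (rotB u⁻¹ J) γ h1 h2
    rw [← hentry, rotB_rotB_inv, geoZd_wNorm_rotB x (inv_mem_unitaryUnits hu)] at h'
    exact h'

end Frame

/-! ## §4  The genuine four-letter record `opsAllZd` at a member with finite `Ω₀` -/

section Record

variable {𝔸 : Type} [CStarAlgebra 𝔸] [FiniteDimensional ℝ 𝔸] [Nontrivial 𝔸] {L : ℕ} {len : Site d → ℝ} (τ : 𝔸 →ₗ[ℂ] ℂ)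
  (ΛbP : ℕ → ℕ → Set (Site d × Fin d)) (ops₀ : ℝ → ZdIdx d L → ℕ → OpsZd d 𝔸) (x : MemberZd d L) {u : Site d → 𝔸ˣ} {U₀ : Site d → Fin d → 𝔸ˣ}

/-- ★★ **FOR THE GENUINE RECORD**: the (3.47) clause of Theorem 3.3's block for `GAZd 𝔸 L len x (opsAllZd τ L ΛbP ops₀ x.M x.i x.m) loc` holds at `U₀^u` iff at
`U₀` — finite `Ω₀`, `τ` tracial Hermitian faithful, unitary `U₀`, unitary `u`, `2 ≤ L`, the P₀ box clause (the `G(U₀)` covariance is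
`B9Eq334GaugeCovarianceZd.gop_opsAllZd_gaugeAct`), the n = 2 letter's invariance displayed. [cite: Balaban1985BackgroundPropagators, (3.47) p.398, (3.34)–(3.36) p.396, Thm 3.3 p.399] -/
theorem glob347_opsAllZd_gaugeAct_iff (hL : 2 ≤ L)
    (hbox : ∀ j, 1 ≤ j → j ≤ x.m → ∀ c ∈ ΛbP x.m j, ∀ y, InBox (loK L j c.1) (bondHiK L j c.1 c.2) y → y ∈ x.i.Ω (j - 1))
    (hτt : ∀ a b : 𝔸, τ (a * b) = τ (b * a)) (hτs : ∀ a : 𝔸, τ (star a) = starRingEnd ℂ (τ a)) (hτp : ∀ a : 𝔸, a ≠ 0 → 0 < (τ (star a * a)).re)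
    (hU₀ : ∀ z κ, U₀ z κ ∈ unitaryUnits 𝔸) (hu : ∀ z, u z ∈ unitaryUnits 𝔸) (hΩ : (x.i.Ω 0).Finite) (loc : LocalLettersZd 𝔸 L x)
    (hglob2 : ∀ (J : Site d → Fin d → 𝔸) (γ : ℝ), loc.glob2 ⟨gaugeAct u U₀, gaugeAct_mem_unitaryUnits' hU₀ hu⟩ (rotB u J) γ = loc.glob2 ⟨U₀, hU₀⟩ J γ)
    (B₀ : ℝ) :
    (∀ (n : Fin 4) (J : Site d → Fin d → 𝔸) (γ : ℝ), -4 ≤ γ → γ ≤ 4 →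
        (GAZd 𝔸 L len x (opsAllZd τ L ΛbP ops₀ x.M x.i x.m) loc).glob n ⟨gaugeAct u U₀, gaugeAct_mem_unitaryUnits' hU₀ hu⟩ J γ ≤
          B₀ * (geoZd 𝔸 L len x).wNorm γ J) ↔
      (∀ (n : Fin 4) (J : Site d → Fin d → 𝔸) (γ : ℝ), -4 ≤ γ → γ ≤ 4 →
        (GAZd 𝔸 L len x (opsAllZd τ L ΛbP ops₀ x.M x.i x.m) loc).glob n ⟨U₀, hU₀⟩ J γ ≤ B₀ * (geoZd 𝔸 L len x).wNorm γ J) :=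
  glob347_gaugeAct_iff x _ hU₀ hu (fun J => gop_opsAllZd_gaugeAct τ L ΛbP ops₀ x.M x.i x.m hL hbox hτt hτs hτp hU₀ hu hΩ J) loc hglob2 B₀

end Record

end Literature.MathematicalPhysics.QuantumFieldTheory.Balaban1983to89.B9Eq347GlobalNormsGaugeInvariantZd

end
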